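import Summits.QuantumFields.BalabanUV.T4Continuum.Support.B13ReadingsDecay

/-!
# B13ReadingsLevelWindow — LEVEL-WINDOWED twins of the W1 tower readings of record (`ReadsTowerCovAOn S` ∕ `ReadsTowerCovBOn S`): the readings are
# consumed pointwise in the aligned index `k`, so an instance with a FINITE run A displays them on `S := {k | k ≤ K}` only (substrate-typer's located
# point T-S19; ruling R55 (R-i))

Cell `pub-balaban`, unit `b2b-balaban-t4-ne5-p1` (row NE5 OWNER, gen 37; owner item «g37-c», ruling R55 = answer to the substrate-typer's Q-S19,
`HOME/CLAIMS.log` l.19999; companion of `B13ReadingsLevelShift` (g37-b, ruling R53) — the readings `ReadsTowerCovA`∕`ReadsTowerCovB` are this lineage's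
W1 readings OF RECORD, `B13ReadingsDecay` p219966).  Summits-side NEW WORK under the LEAN PLACEMENT RULE: two HYPOTHESIS SHAPES (`def … : Prop` binders,
review-queued as data — level-windowed copies of the accepted shapes, [folklore]) + four [folklore] bookkeeping theorems; nothing printed is asserted; no
`[cite:]`.  HONEST FRAMING: rung (B)+1 of the FINITE-VOLUME T⁴ continuum programme — NOT infinite volume, NOT a mass gap, NOT the Clay problem, NOT a proof
of NE5 (NOT PRINTED; GAPS G-t4-U3-1), NOT a proof of NE2 or NE3.  HONEST DEPENDENCY (cell, verbatim): continuum YM on T⁴ ⇐ BetaPertH ∧ nine spine estimates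
(0/9 proved); BetaPertH ⇐ (D1) ∧ (D4) ∧ CAP+tail; G-an2-4 gates asym, D1 and NE2/3/4.

WHY (T-S19, substrate-typer gen 11, l.19999 — a typing fact of the tree).  `ReadsTowerCovA`∕`ReadsTowerCovB` quantify over ALL aligned indices `k : ℕ`.
On the substrate's carriers run A has `K` levels: its record covariance slot reads `0` at every aligned `k > K` (`SubstrateRawSpecies.covAtOfRecord_of_lt`),
while run B's slot — once shifted one level deeper per rulings R53∕R54 (W-21) — reads at aligned `K` its REAL top-level covariance (depth `K + 1`).  With a
step-blind reading map the two full-`ℕ` readings then say `0 = c (U) (K+1)` (from `hcovA` at `k = K+1`) and `covB_top = c (U) (K+1)` (from `hcovB` at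
`k = K`): run B's top-level covariance would have to VANISH on every read entry — a vacuity ABOVE THE TOP, invisible to the same-level∕shift analysis of
g37-b and independent of it.  Nothing landed is false (displayed binders); the remedy is to DISPLAY the readings on the window of meaningful indices
`S := {k | k ≤ K}` (= NE5's `C.scale X ≤ K` on the carriers of record) — the consumer `B13ReadingsDecay.cov_entryBound_of_twoLevelDecayRate` is
pointwise in `k`, so nothing is lost — and to let the instance prove the full-`ℕ` `WeightedEntrywiseRate` by cases (`k ≤ K`: this file; `K < k`: both cov
slots `0` after W-21, `‖0 − 0‖`).  That is ruling R55 (R-i), the typer's recommendation adopted; the substrate's W-21b (`SubstrateO1ReadingsShift`) displays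
`ReadsTowerCovAOn {k | k ≤ D.K}` ∕ `ReadsTowerCovBOn {k | k ≤ D.K}` by name.

WHAT.
* `ReadsTowerCovAOn S` ∕ `ReadsTowerCovBOn S` (defs; [folklore] hypothesis shapes), `readsTowerCovOn_of_readsTowerCov` (full ⟹ windowed),
  `cov_entryBound_of_twoLevelDecayRate_on` (the windowed consumer, same three lines as p219966's), `readsTowerCovOn_of_shiftedSlots` (windowed twin of
  g37-b §4: run B's slot one level deeper at the same datum on `S`), `cov_entryBound_of_shiftedSlots_on` (windowed twin of g37-b §5: W1 for the covariance
  species on `S` IS the tower's two-level rate).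
0 sorry; axioms ⊆ {propext, Classical.choice, Quot.sound}.
-/

noncomputable section

open scoped BigOperators Matrix

namespace Summit.QuantumFields.BalabanUV.T4Continuum.B13ReadingsLevelWindow

open Summit.QuantumFields.BalabanUV.T4Continuum.B13OpDatum
open Summit.QuantumFields.BalabanUV.T4Continuum.B13ReadingsDecay (ReadsTowerCovA ReadsTowerCovB CovWeightDominatesDist)
open Summit.QuantumFields.BalabanUV.T4Continuum.DecayRateInterpolation (TwoLevelDecayRate)

variable {T κ ι Ω 𝒴 Bg J n : Type*}

/-! ## §1 The windowed shapes and the windowed consumer -/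

/-- HYPOTHESIS SHAPE **`ReadsTowerCovAOn S`** — `ReadsTowerCovA` restricted to the aligned indices `k ∈ S` (intended `S := {k | k ≤ D.K}`, NE5's
`C.scale X ≤ K` on the carriers of record): above run A's top level the record's cov slots read junk (`0`), and the full-`ℕ` shape would force the
tower member there to vanish on the read entries (substrate-typer T-S19, `HOME/CLAIMS.log` l.19999). [folklore] -/
def ReadsTowerCovAOn (S : Set ℕ) (c : J → ℕ → Matrix n n ℂ) (σ : T → κ → n) (tow : ℕ → (ℕ → ℝ) → Bg → J)
    (rawA : (ℕ → ℝ) → Bg → ℕ → RawSpecies T κ ι Ω 𝒴) (W : Set (ℕ → ℝ)) : Prop :=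
  ∀ k ∈ S, ∀ g ∈ W, ∀ (U : Bg) (t : T) (p q : κ), (rawA g U k).cov t p q = c (tow k g U) k (σ t p) (σ t q)

/-- HYPOTHESIS SHAPE **`ReadsTowerCovBOn S`** — `ReadsTowerCovB` (run B one level deeper) restricted to `k ∈ S`. [folklore] -/
def ReadsTowerCovBOn (S : Set ℕ) (c : J → ℕ → Matrix n n ℂ) (σ : T → κ → n) (tow : ℕ → (ℕ → ℝ) → Bg → J)
    (rawB : (ℕ → ℝ) → Bg → ℕ → RawSpecies T κ ι Ω 𝒴) (W : Set (ℕ → ℝ)) : Prop :=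
  ∀ k ∈ S, ∀ g ∈ W, ∀ (U : Bg) (t : T) (p q : κ), (rawB g U k).cov t p q = c (tow k g U) (k + 1) (σ t p) (σ t q)

/-- [folklore] The full-`ℕ` readings restrict to every window. -/
theorem readsTowerCovOn_of_readsTowerCov (S : Set ℕ) {c : J → ℕ → Matrix n n ℂ} {σ : T → κ → n} {tow : ℕ → (ℕ → ℝ) → Bg → J}
    {rawA rawB : (ℕ → ℝ) → Bg → ℕ → RawSpecies T κ ι Ω 𝒴} {W : Set (ℕ → ℝ)}
    (hA : ReadsTowerCovA c σ tow rawA W) (hB : ReadsTowerCovB c σ tow rawB W) :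
    ReadsTowerCovAOn S c σ tow rawA W ∧ ReadsTowerCovBOn S c σ tow rawB W :=
  ⟨fun k _ g hg U t p q => hA k g hg U t p q, fun k _ g hg U t p q => hB k g hg U t p q⟩

/-- [folklore] **THE WINDOWED CONSUMER** — `B13ReadingsDecay.cov_entryBound_of_twoLevelDecayRate` is pointwise in `k`, so the windowed readings give the
same covariance entry bound AT EVERY `k ∈ S` (same three lines). -/
theorem cov_entryBound_of_twoLevelDecayRate_on {S : Set ℕ} {Fk : ℕ → Format (Species T κ ι Ω 𝒴)} {c : J → ℕ → Matrix n n ℂ}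
    {σ : T → κ → n} {tow : ℕ → (ℕ → ℝ) → Bg → J} {rawA rawB : (ℕ → ℝ) → Bg → ℕ → RawSpecies T κ ι Ω 𝒴}
    {W : Set (ℕ → ℝ)} {dist : n → n → ℝ} {B δ θ : ℝ} (hB : 0 ≤ B) (hθ : 0 ≤ θ)
    (hrate : ∀ j, TwoLevelDecayRate dist (c j) B δ θ) (hreadA : ReadsTowerCovAOn S c σ tow rawA W)
    (hreadB : ReadsTowerCovBOn S c σ tow rawB W) (hdom : CovWeightDominatesDist Fk dist σ δ) {k : ℕ} (hk : k ∈ S) {g : ℕ → ℝ}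
    (hg : g ∈ W) (U : Bg) (t : T) (p q : κ) :
    ‖(rawA g U k).cov t p q - (rawB g U k).cov t p q‖ ≤ B * θ ^ k * (Fk k).wt (.cov t p q) := by
  rw [hreadA k hk g hg U t p q, hreadB k hk g hg U t p q, norm_sub_rev, ← Matrix.sub_apply]
  exact (hrate (tow k g U) k (σ t p) (σ t q)).trans
    (mul_le_mul_of_nonneg_left (hdom k t p q) (mul_nonneg hB (pow_nonneg hθ k)))

/-! ## §2 Shifted slots on the window -/

/-- [folklore] **WINDOWED twin of `B13ReadingsLevelShift.readsTowerCov_of_shiftedSlots`**: run B's slot one level deeper at the same datum ON THE WINDOW ⟹ the windowed readings (the substrate's W-21b shape: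
`S := {k | k ≤ D.K}`, run A's guarded identity `covAtOfRecord_carriers_transport`, run B's `rfl`). -/
theorem readsTowerCovOn_of_shiftedSlots (S : Set ℕ) {c : J → ℕ → Matrix n n ℂ} {σ : T → κ → n} (d : (ℕ → ℝ) → Bg → J)
    {sp : J → ℕ → T → κ → κ → ℂ} {rawA rawB : (ℕ → ℝ) → Bg → ℕ → RawSpecies T κ ι Ω 𝒴} {W : Set (ℕ → ℝ)}
    (hsp : ∀ j m t p q, sp j m t p q = c j m (σ t p) (σ t q))
    (hA : ∀ k ∈ S, ∀ g ∈ W, ∀ (U : Bg) (t : T) (p q : κ), (rawA g U k).cov t p q = sp (d g U) k t p q)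
    (hB : ∀ k ∈ S, ∀ g ∈ W, ∀ (U : Bg) (t : T) (p q : κ), (rawB g U k).cov t p q = sp (d g U) (k + 1) t p q) :
    ReadsTowerCovAOn S c σ (fun _ g U => d g U) rawA W ∧ ReadsTowerCovBOn S c σ (fun _ g U => d g U) rawB W :=
  ⟨fun k hk g hg U t p q => by rw [hA k hk g hg U t p q, hsp], fun k hk g hg U t p q => by rw [hB k hk g hg U t p q, hsp]⟩

/-- [folklore] **WINDOWED twin of `B13ReadingsLevelShift.cov_entryBound_of_shiftedSlots`**: shifted slots on the window + the tower's two-level rate ⟹ the W1 covariance entry bound at every `k ∈ S`. -/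
theorem cov_entryBound_of_shiftedSlots_on {S : Set ℕ} {Fk : ℕ → Format (Species T κ ι Ω 𝒴)} {c : J → ℕ → Matrix n n ℂ} {σ : T → κ → n}
    (d : (ℕ → ℝ) → Bg → J) {sp : J → ℕ → T → κ → κ → ℂ} {rawA rawB : (ℕ → ℝ) → Bg → ℕ → RawSpecies T κ ι Ω 𝒴} {W : Set (ℕ → ℝ)}
    {dist : n → n → ℝ} {B δ θ : ℝ} (hB : 0 ≤ B) (hθ : 0 ≤ θ)
    (hsp : ∀ j m t p q, sp j m t p q = c j m (σ t p) (σ t q))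
    (hA : ∀ k ∈ S, ∀ g ∈ W, ∀ (U : Bg) (t : T) (p q : κ), (rawA g U k).cov t p q = sp (d g U) k t p q)
    (hB' : ∀ k ∈ S, ∀ g ∈ W, ∀ (U : Bg) (t : T) (p q : κ), (rawB g U k).cov t p q = sp (d g U) (k + 1) t p q)
    (hrate : ∀ j, TwoLevelDecayRate dist (c j) B δ θ) (hdom : CovWeightDominatesDist Fk dist σ δ)
    {k : ℕ} (hk : k ∈ S) {g : ℕ → ℝ} (hg : g ∈ W) (U : Bg) (t : T) (p q : κ) :
    ‖(rawA g U k).cov t p q - (rawB g U k).cov t p q‖ ≤ B * θ ^ k * (Fk k).wt (.cov t p q) := by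
  obtain ⟨hrA, hrB⟩ := readsTowerCovOn_of_shiftedSlots (c := c) (σ := σ) S d hsp hA hB'
  exact cov_entryBound_of_twoLevelDecayRate_on hB hθ hrate hrA hrB hdom hk hg U t p q

end Summit.QuantumFields.BalabanUV.T4Continuum.B13ReadingsLevelWindow

end
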